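import Literature.NumberTheory.Automorphic.Liu2021.Thm418AsPrinted
import Literature.NumberTheory.Automorphic.IdeleClassCharacterValueFieldCM
import HarnessLib

/-!
# [Liu21] §4.1: the AS-PRINTED typing's `M_μ` (`Liu2021.fieldOfValues`) is the tree's `muAlgValueField` — hence a CM number field

Topic `NumberTheory/Automorphic`; namespace `Literature.NumberTheory.Automorphic.Liu2021`.  **Theorems only** (no definition, no
instance, no named fact, no `sorry`).  Bridge between the statement-exact typing of [Liu2021, Thm. 4.18]
(`Liu2021/Thm418AsPrinted.lean`, cell pub-hodgecm2: `muAlgValue E μ x = μ([x])·‖x‖_E^{-1/2}` as a real power `rpow (-1/2)`,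
`fieldOfValues E μ = ℚ(μ^{alg}(x) : x_∞ = 1)` as `IntermediateField.adjoin`) and the tree's earlier rendering of the SAME printed
sentence (`IdeleClassCharacterAlgebraicTwist.lean`: `IdeleClassGroup.muAlg` with `(√‖x‖)⁻¹`, `IdeleClassGroup.muAlgValueField` as
`Subfield.closure`), so that everything proved about `muAlgValueField` — "`M_μ` is a number field" (`finiteDimensional_muAlgValueField`),
"containing `M'_μ`" (`traceField_le_muAlgValueField_of_odd`), "`M_μ` is a CM field" (`IsConjugateSymplectic.isCMField_muAlgValueField`,
`IdeleClassCharacterValueFieldCM.lean`) — transfers to the carrier `fieldOfValues E μ` over which `Thm418Data.Ω`, `galoisAct`, … are typed.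

AS PRINTED (§4.1, TeX ll. 1924–1928): "We put `μ^{alg} ≔ μ · | |_E^{-1/2}`, which is then algebraic. Denote by `M_μ ⊆ ℂ` the subfield
generated by values `μ^{alg}(x)` for `x ∈ (𝔸_E^∞)^×`, which is a number field containing `M'_μ`."

* `muAlgValue_eq_coe_muAlg` — `muAlgValue E μ x = μ^{alg}(x)` (`r^{-1/2} = (√r)⁻¹` for `r ≥ 0`);
* `fieldOfValues_toSubfield` — `(fieldOfValues E μ).toSubfield = muAlgValueField E μ` (`ℚ ⊆` every subfield of `ℂ`);
* `mem_fieldOfValues_iff`;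
* `numberField_fieldOfValues` ∕ `isCMField_fieldOfValues` for conjugate symplectic `μ` of a CM field, and the `Thm418Data` forms
  `Thm418Data.numberField_fieldOfValues` ∕ `Thm418Data.isCMField_fieldOfValues` (the datum's `μ` is conjugate symplectic,
  `Thm418Data.isConjugateSymplectic`), `Thm418Data.hasCMType_cmType` (the datum's `μ` has CM type `D.cmType`),
  `Thm418Data.numberField_muAlgValueField` ∕ `Thm418Data.isCMField_muAlgValueField`.

## References

* [Liu2021] Y. Liu, *Fourier–Jacobi cycles and arithmetic relative trace formula*, Camb. J. Math. 9 (2021), no. 1, 1–147,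
  arXiv:2102.11518 — §4.1, text after Def. 4.3 (TeX ll. 1924–1928); Def. 4.5 (2) (ll. 1944–1951).
-/

set_option autoImplicit false

noncomputable section

open scoped NNReal
open NumberField

namespace Literature.NumberTheory.Automorphic.Liu2021

open GaloisRepresentations IdeleClassGroup

section Bridge

variable (E : Type) [Field E] [NumberField E]

/-- **`μ^{alg}(x)` as typed AS PRINTED equals the tree's `muAlg`**: `μ([x]) · ‖x‖^{-1/2} = μ([x]) · (√‖x‖)⁻¹`.
[cite: Liu2021, §4.1 (TeX ll. 1924–1926)] -/
theorem muAlgValue_eq_coe_muAlg (μ : IdeleClassGroup E →ₜ* Circle) (x : ideleGroup E) :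
    muAlgValue E μ x = ((muAlg E μ x : ℂˣ) : ℂ) := by
  rw [muAlgValue, coe_muAlg_apply, coe_ideleNorm]
  congr 1
  have h0 : 0 ≤ GaloisRepresentations.ideleNorm x := by rw [← coe_ideleNorm]; exact NNReal.coe_nonneg _
  rw [show (-(1 : ℝ) / 2) = -((1 : ℝ) / 2) by ring, Real.rpow_neg h0, ← Real.sqrt_eq_rpow, Complex.ofReal_inv]

/-- **The AS-PRINTED `M_μ` is the tree's `M_μ`**: `(fieldOfValues E μ).toSubfield = muAlgValueField E μ` (the intermediate field of
`ℂ/ℚ` generated by the `μ^{alg}(x)`, `x_∞ = 1`, has the same underlying subfield as the subfield they generate, `ℚ` lying in every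
subfield of `ℂ`). [cite: Liu2021, §4.1 (TeX ll. 1926–1928)] -/
theorem fieldOfValues_toSubfield (μ : IdeleClassGroup E →ₜ* Circle) :
    (fieldOfValues E μ).toSubfield = muAlgValueField E μ := by
  have hS : {z : ℂ | ∃ x : ideleGroup E, (x : AdeleRing (𝓞 E) E).1 = 1 ∧ z = muAlgValue E μ x} =
      Set.range (fun x : {x : ideleGroup E // (x : AdeleRing (𝓞 E) E).1 = 1} => ((muAlg E μ x.1 : ℂˣ) : ℂ)) := by
    ext z
    simp only [Set.mem_setOf_eq, Set.mem_range, Subtype.exists, muAlgValue_eq_coe_muAlg]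
    constructor
    · rintro ⟨x, hx, rfl⟩; exact ⟨x, hx, rfl⟩
    · rintro ⟨x, hx, rfl⟩; exact ⟨x, hx, rfl⟩
  rw [fieldOfValues, IntermediateField.adjoin_toSubfield, hS, muAlgValueField_eq_closure_range]
  apply le_antisymm
  · refine Subfield.closure_le.2 (Set.union_subset ?_ Subfield.subset_closure)
    rintro _ ⟨q, rfl⟩
    exact SubfieldClass.ratCast_mem _ q
  · exact Subfield.closure_mono Set.subset_union_right

/-- Membership form of `fieldOfValues_toSubfield`. [cite: Liu2021, §4.1 (TeX ll. 1926–1928)] -/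
theorem mem_fieldOfValues_iff (μ : IdeleClassGroup E →ₜ* Circle) (z : ℂ) :
    z ∈ fieldOfValues E μ ↔ z ∈ muAlgValueField E μ := by
  rw [← IntermediateField.mem_toSubfield, fieldOfValues_toSubfield]

variable {E}

/-- **"… which is a number field"** for the AS-PRINTED carrier: `fieldOfValues E μ` is a number field for conjugate symplectic `μ`
of a CM field `E`. [cite: Liu2021, §4.1 (TeX ll. 1926–1928)] -/
theorem numberField_fieldOfValues [IsCMField E] {μ : IdeleClassGroup E →ₜ* Circle} (hμ : IsConjugateSymplectic E μ) :
    NumberField (fieldOfValues E μ) := by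
  haveI : FiniteDimensional ℚ (muAlgValueField E μ) := hμ.finiteDimensional_muAlgValueField
  let f : fieldOfValues E μ →ₐ[ℚ] muAlgValueField E μ :=
    { toFun := fun z => ⟨(z : ℂ), (mem_fieldOfValues_iff E μ z).1 z.2⟩
      map_one' := rfl
      map_mul' := fun _ _ => rfl
      map_zero' := rfl
      map_add' := fun _ _ => rfl
      commutes' := fun q => Subtype.ext (by simp) }
  have hf : Function.Injective f := fun a b hab => Subtype.ext (congrArg (fun w : muAlgValueField E μ => (w : ℂ)) hab)
  exact { to_charZero := inferInstance
          to_finiteDimensional := FiniteDimensional.of_injective f.toLinearMap hf }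

/-- **The AS-PRINTED `M_μ` is a CM field** for conjugate symplectic `μ` of a CM field `E` ([Liu2021] Def. 4.5 (2): `A_μ` has CM by
`M_μ`), transported from `IsConjugateSymplectic.isCMField_muAlgValueField` along `fieldOfValues_toSubfield`.
[cite: Liu2021, §4.1 (TeX ll. 1926–1928) and Def. 4.5 (2) (ll. 1944–1951)] -/
theorem isCMField_fieldOfValues [IsCMField E] {μ : IdeleClassGroup E →ₜ* Circle} (hμ : IsConjugateSymplectic E μ) :
    IsCMField (fieldOfValues E μ) := by
  haveI := hμ.numberField_muAlgValueField
  haveI := numberField_fieldOfValues hμ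
  have hCM := hμ.isCMField_muAlgValueField
  let e : fieldOfValues E μ ≃+* muAlgValueField E μ :=
    { toFun := fun z => ⟨(z : ℂ), (mem_fieldOfValues_iff E μ z).1 z.2⟩
      invFun := fun w => ⟨(w : ℂ), (mem_fieldOfValues_iff E μ w).2 w.2⟩
      left_inv := fun _ => rfl
      right_inv := fun _ => rfl
      map_mul' := fun _ _ => rfl
      map_add' := fun _ _ => rfl }
  exact NumberFields.isCMField_of_ringEquiv e hCM

end Bridge

namespace Thm418Data

variable {F E : Type} [Field F] [NumberField F] [IsTotallyReal F] [Field E] [NumberField E] [Algebra F E]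
  [IsTotallyComplex E] [Algebra.IsQuadraticExtension F E] (D : Thm418Data F E)

/-- The `M_μ` of a datum of [Liu2021, Thm. 4.18] AS PRINTED is a number field. [cite: Liu2021, §4.1 (TeX ll. 1926–1928)] -/
theorem numberField_fieldOfValues : NumberField (fieldOfValues E D.μ) :=
  letI : IsCMField E := Liu2021.isCMField F E
  Liu2021.numberField_fieldOfValues D.isConjugateSymplectic

/-- The `M_μ` of a datum of [Liu2021, Thm. 4.18] AS PRINTED is a CM field. [cite: Liu2021, §4.1 and Def. 4.5 (2)] -/
theorem isCMField_fieldOfValues : IsCMField (fieldOfValues E D.μ) :=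
  letI : IsCMField E := Liu2021.isCMField F E
  Liu2021.isCMField_fieldOfValues D.isConjugateSymplectic

/-- The datum's `μ` HAS the CM type `D.cmType = Φ_μ` (Def. 4.3 (2); `IsConjugateSymplectic.hasCMType_cmType`) — the
`HasCMType` input (`hT`) of the Liu-pin theorems `Model.exists_liuPin_reach` ∕ `exists_liuPin_isCMTypeRealisation`
(`Summits/HodgeConjecture/CorCM/LiuValueFieldPin.lean`) at `Θ := D.cmType`. [cite: Liu2021, Def. 4.3 (2)] -/
theorem hasCMType_cmType :
    letI : IsCMField E := Liu2021.isCMField F E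
    IdeleClassGroup.HasCMType E D.μ D.cmType :=
  letI : IsCMField E := Liu2021.isCMField F E
  D.isConjugateSymplectic.hasCMType_cmType

/-- The tree's `M_μ` (`muAlgValueField`) of the datum's `μ` is a number field (for pins phrased over `muAlgValueField`).
[cite: Liu2021, §4.1 (TeX ll. 1926–1928)] -/
theorem numberField_muAlgValueField : NumberField (muAlgValueField E D.μ) :=
  letI : IsCMField E := Liu2021.isCMField F E
  D.isConjugateSymplectic.numberField_muAlgValueField

/-- The tree's `M_μ` (`muAlgValueField`) of the datum's `μ` is a CM field. [cite: Liu2021, §4.1 and Def. 4.5 (2)] -/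
theorem isCMField_muAlgValueField : IsCMField (muAlgValueField E D.μ) :=
  letI : IsCMField E := Liu2021.isCMField F E
  D.isConjugateSymplectic.isCMField_muAlgValueField

end Thm418Data

end Literature.NumberTheory.Automorphic.Liu2021

end
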